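import Mathlib.Analysis.Calculus.Deriv.Slope
import Mathlib.Analysis.Calculus.Deriv.Comp
import Mathlib.Analysis.Calculus.FDeriv.Basic
import Mathlib.Order.Filter.Finite
import Mathlib.Topology.MetricSpace.Basic
import HarnessLib

/-!
# Positive invariance of a finite intersection of sublevel sets (max-type Lyapunov functions)

Topic `Literature/Analysis/ODE` (namespace `Literature.Analysis.ODE`). Companion of
`LyapunovSublevelInvariance.lean` (one smooth `V`): here the candidate invariant set is a FINITE
INTERSECTION `S = ⋂ₖ {x | gₖ x ≤ cₖ}` — equivalently the sublevel set `{V ≤ 0}` of the non-smooth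
max-type function `V = maxₖ (gₖ - cₖ)` — and the hypothesis is the strict ACTIVE-FACE condition:
at every point of `S` where a constraint is active (`gₖ x = cₖ`) that constraint strictly decreases
along the field (`ġₖ(x) < 0`). Conclusion: every solution starting in `S` stays in `S`.

This is the argument behind the «contraction of the arc containing all phases» proofs of the
consensus / Kuramoto literature: there `V(θ) = max_{i,j} (θᵢ − θⱼ)` and, by Danskin's formula for the
upper Dini derivative of a maximum of `C¹` functions [LinFrancisMaggiore2007, §2.3 Lemma 2.2],
`D⁺V = θ̇ₘ − θ̇_ℓ` over the active pairs; «`Δ̄(γ)` is positively invariant if and only if `V(θ(t))`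
does not increase at any time `t` such that `V(θ(t)) = γ`» [DorflerBullo2012, proof of Thm 5.3 of the
arXiv text 0910.5673]. We avoid Dini derivatives altogether: the proof is a first-exit-time argument
on finitely many real functions `t ↦ gₖ(X t)` (closedness from the left by continuity, openness to the
right from the sign of the derivative of the active constraints and continuity of the inactive ones,
finiteness to intersect the neighbourhoods).

Contents:
* `forall_le_of_hasDerivWithinAt_of_eq_imp_deriv_neg` — the scalar core: finitely many real functions
  `hₖ` on `[0, T]` with `hₖ 0 ≤ cₖ`, differentiable within `[0, T]`, such that whenever all `hⱼ t ≤ cⱼ`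
  and `hₖ t = cₖ` the derivative of `hₖ` at `t` is `< 0`, satisfy `hₖ t ≤ cₖ` on `[0, T]`.
* `forall_le_of_hasDerivWithinAt_of_levels_above` — the same conclusion when the strict face condition
  is only known for the shifted levels `cₖ + ε`, `0 < ε < δ` (recovers non-strict printed statements
  such as «`K ≥ K(γ)`»).
* `forall_le_of_solution_of_active_lt` — the ODE phrasing: `X' = F(X)` within `[0, T]`, constraint
  functionals `gₖ` with Fréchet derivatives `gₖ'`, face condition `gₖ' x (F x) < 0` at active
  constraints of points of `S` ⇒ `X t ∈ S`.

Tree convention for solutions (as in `LyapunovSublevelInvariance.lean`): a solution on `[0, T]` is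
`∀ t ∈ Icc 0 T, HasDerivWithinAt X (F (X t)) (Icc 0 T) t`; statements are a priori (no existence
claim is made or needed).

## References
* Z. Lin, B. Francis, M. Maggiore, *State agreement for continuous-time coupled nonlinear systems*,
  SIAM J. Control Optim. 46 (2007) 288–307, §2.3 Lemma 2.2 (Danskin formula). Key `LinFrancisMaggiore2007`.
* F. Dörfler, F. Bullo, *Synchronization and transient stability in power networks and non-uniform
  Kuramoto oscillators*, SIAM J. Control Optim. 50 (2012); long version arXiv:0910.5673, §5.2, proof of
  Thm 5.3. Key `DorflerBullo2012`.
-/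

noncomputable section

open Set Filter
open _root_.Topology

namespace Literature.Analysis.ODE

variable {ι : Type*} [Finite ι]

/-- **Finitely many scalar barriers with strictly decreasing active constraints cannot be crossed.**
Let `hₖ : ℝ → ℝ` (`k` in a finite index type) have derivative `hₖ' t` within `[0, T]` at every
`t ∈ [0, T]`, start below their levels (`hₖ 0 ≤ cₖ`), and satisfy the strict active-face condition: at
any `t ∈ [0, T]` at which ALL `hⱼ t ≤ cⱼ` and `hₖ t = cₖ`, one has `hₖ' t < 0`. Then `hₖ t ≤ cₖ` for all
`t ∈ [0, T]` and all `k`. Proof: if not, let `t₁` be the infimum of the bad times; all times before `t₁`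
are good, hence (continuity from the left) `t₁` is good; at `t₁` every active constraint has negative
derivative, so it is `< cₖ` just after `t₁` (slope form of the derivative), and every inactive one stays
`< cₖ` by continuity; finiteness gives a common right-neighbourhood of good times — contradicting the
choice of `t₁`. This is the Dini-derivative-free form of «`V = maxₖ hₖ` does not increase when
`V = c`» [cite: LinFrancisMaggiore2007, §2.3 Lemma 2.2 (Danskin formula for `D⁺ max`), as used in
DorflerBullo2012 proof of Thm 5.3 (arXiv:0910.5673 §5.2)]. -/
theorem forall_le_of_hasDerivWithinAt_of_eq_imp_deriv_neg {h h' : ι → ℝ → ℝ} {c : ι → ℝ} {T : ℝ}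
    (hder : ∀ k, ∀ t ∈ Icc 0 T, HasDerivWithinAt (h k) (h' k t) (Icc 0 T) t)
    (hface : ∀ t ∈ Icc 0 T, (∀ j, h j t ≤ c j) → ∀ k, h k t = c k → h' k t < 0)
    (h0 : ∀ k, h k 0 ≤ c k) : ∀ t ∈ Icc 0 T, ∀ k, h k t ≤ c k := by
  by_contra hcon
  push Not at hcon
  obtain ⟨t₂, ht₂, k₂, hk₂⟩ := hcon
  set B : Set ℝ := {t | t ∈ Icc 0 T ∧ ∃ k, c k < h k t} with hB
  have hBne : B.Nonempty := ⟨t₂, ht₂, k₂, hk₂⟩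
  have hBbdd : BddBelow B := ⟨0, fun t ht => ht.1.1⟩
  set t₁ := sInf B with ht₁
  have ht₁0 : 0 ≤ t₁ := le_csInf hBne fun b hb => hb.1.1
  have ht₁T : t₁ ≤ T := (csInf_le hBbdd ⟨ht₂, k₂, hk₂⟩).trans ht₂.2
  have ht₁I : t₁ ∈ Icc 0 T := ⟨ht₁0, ht₁T⟩
  have hcts : ∀ k, ContinuousWithinAt (h k) (Icc 0 T) t₁ :=
    fun k => (hder k t₁ ht₁I).continuousWithinAt
  -- times before `t₁` are good
  have hgood : ∀ s ∈ Icc 0 T, s < t₁ → ∀ k, h k s ≤ c k := by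
    intro s hs hst k
    by_contra hlt
    push Not at hlt
    exact absurd (csInf_le hBbdd ⟨hs, k, hlt⟩) (not_le.2 hst)
  -- hence `t₁` itself is good
  have hgood₁ : ∀ k, h k t₁ ≤ c k := by
    intro k
    rcases ht₁0.eq_or_lt with h01 | h01
    · rw [← h01]
      exact h0 k
    · have hIco : Ico 0 t₁ ⊆ Icc 0 T := fun s hs => ⟨hs.1, hs.2.le.trans ht₁T⟩
      have htend : Tendsto (h k) (𝓝[Ico 0 t₁] t₁) (𝓝 (h k t₁)) := ((hcts k).mono hIco).tendsto
      have hcl : t₁ ∈ closure (Ico 0 t₁) := by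
        rw [closure_Ico h01.ne]
        exact right_mem_Icc.2 h01.le
      haveI : (𝓝[Ico 0 t₁] t₁).NeBot := mem_closure_iff_nhdsWithin_neBot.1 hcl
      have hev : ∀ᶠ s in 𝓝[Ico 0 t₁] t₁, h k s ∈ Iic (c k) :=
        eventually_nhdsWithin_of_forall fun s hs => hgood s (hIco hs) hs.2 k
      exact isClosed_Iic.mem_of_tendsto htend hev
  -- and so is a right-neighbourhood of `t₁` within `[0, T]`
  have hafter : ∀ᶠ s in 𝓝[Icc 0 T ∩ Ioi t₁] t₁, ∀ k, h k s ≤ c k := by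
    rw [Filter.eventually_all]
    intro k
    rcases (hgood₁ k).lt_or_eq with hlt | heq
    · -- inactive constraint: continuity
      have h1 : ∀ᶠ s in 𝓝[Icc 0 T] t₁, h k s ∈ Iio (c k) :=
        (hcts k).tendsto.eventually (Iio_mem_nhds hlt)
      exact (h1.filter_mono (nhdsWithin_mono _ inter_subset_left)).mono fun s hs => le_of_lt hs
    · -- active constraint: negative derivative
      have hd : h' k t₁ < 0 := hface t₁ ht₁I hgood₁ k heq
      have hsl : ∀ᶠ z in 𝓝[Icc 0 T \ {t₁}] t₁, slope (h k) t₁ z < 0 :=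
        (hder k t₁ ht₁I).limsup_slope_le hd
      have hsub : Icc 0 T ∩ Ioi t₁ ⊆ Icc 0 T \ {t₁} :=
        fun z hz => ⟨hz.1, fun hzt => (ne_of_gt (show t₁ < z from hz.2)) hzt⟩
      have h2 := hsl.filter_mono (nhdsWithin_mono _ hsub)
      filter_upwards [h2, eventually_mem_nhdsWithin] with z hz hzmem
      rw [slope_def_field] at hz
      have hpos : 0 < z - t₁ := sub_pos.2 hzmem.2
      have hnum : h k z - h k t₁ < 0 := by
        have := (div_lt_iff₀ hpos).1 hz
        simpa using this
      linarith
  rw [eventually_nhdsWithin_iff, Metric.eventually_nhds_iff] at hafter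
  obtain ⟨ε, hε, hball⟩ := hafter
  have ht₁B : t₁ ∉ B := by
    rintro ⟨-, k, hk⟩
    exact absurd (hgood₁ k) (not_le.2 hk)
  obtain ⟨b, hbB, hblt⟩ := exists_lt_of_csInf_lt hBne (show sInf B < t₁ + ε by linarith)
  have hbge : t₁ ≤ b := csInf_le hBbdd hbB
  have hbne : b ≠ t₁ := fun hbt => ht₁B (hbt ▸ hbB)
  have hbgt : t₁ < b := lt_of_le_of_ne hbge (Ne.symm hbne)
  have hdist : dist b t₁ < ε := by
    rw [Real.dist_eq, abs_of_nonneg (by linarith)]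
    linarith
  obtain ⟨hbI, k, hk⟩ := hbB
  exact absurd (hball hdist ⟨hbI, hbgt⟩ k) (not_le.2 hk)

/-- **Non-strict levels from strict levels just above.** If the strict active-face condition of
`forall_le_of_hasDerivWithinAt_of_eq_imp_deriv_neg` is known for all the SHIFTED level vectors
`c + ε`, `0 < ε < δ` (same shift for every constraint), then the barriers `hₖ ≤ cₖ` themselves are not
crossed: `hₖ t ≤ cₖ + ε` for every small `ε`, hence `hₖ t ≤ cₖ`. (This is how a printed non-strict
condition — decrease of the max-type function on the levels in `]c, c + δ[` — yields invariance of the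
closed set `{V ≤ c}`; it does NOT apply at a level above which the decrease fails.)
[cite: DorflerBullo2012, arXiv:0910.5673 §5.2 proof of Thm 5.3 («`V(θ(t))` is non-increasing in `Δ̄(γ)` for all
`γ ∈ [γ_min, γ_max]` … strictly decreasing … for all `γ ∈ ]γ_min, γ_max[`») and Remark 5.4 eq. (Kuramoto bound on
coupling gain K - 2) (the non-strict «`K ≥ K(γ)`» invariance statement this lemma recovers)] -/
theorem forall_le_of_hasDerivWithinAt_of_levels_above {h h' : ι → ℝ → ℝ} {c : ι → ℝ} {T δ : ℝ}
    (hδ : 0 < δ) (hder : ∀ k, ∀ t ∈ Icc 0 T, HasDerivWithinAt (h k) (h' k t) (Icc 0 T) t)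
    (hface : ∀ ε, 0 < ε → ε < δ → ∀ t ∈ Icc 0 T,
      (∀ j, h j t ≤ c j + ε) → ∀ k, h k t = c k + ε → h' k t < 0)
    (h0 : ∀ k, h k 0 ≤ c k) : ∀ t ∈ Icc 0 T, ∀ k, h k t ≤ c k := by
  intro t ht k
  have hε : ∀ ε, 0 < ε → ε < δ → h k t ≤ c k + ε := by
    intro ε hε0 hεδ
    exact forall_le_of_hasDerivWithinAt_of_eq_imp_deriv_neg (c := fun j => c j + ε) hder
      (hface ε hε0 hεδ) (fun j => (h0 j).trans (le_add_of_nonneg_right hε0.le)) t ht k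
  by_contra hlt
  push Not at hlt
  set ε := min (δ / 2) ((h k t - c k) / 2) with hεdef
  have hε0 : 0 < ε := lt_min (by linarith) (by linarith)
  have hεδ : ε < δ := (min_le_left _ _).trans_lt (by linarith)
  have h1 := hε ε hε0 hεδ
  have h2 : ε ≤ (h k t - c k) / 2 := min_le_right _ _
  linarith

variable {E : Type*} [NormedAddCommGroup E] [NormedSpace ℝ E]

/-- **Positive invariance of a finite intersection of sublevel sets** (ODE phrasing). Let
`S = {x | ∀ k, gₖ x ≤ cₖ}` with each `gₖ` Fréchet differentiable (`gₖ'`), and assume the strict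
active-face condition: for `x ∈ S` and `gₖ x = cₖ`, `gₖ' x (F x) < 0`. Then every solution of
`X' = F(X)` on `[0, T]` (tree convention, derivative within `[0, T]`) with `X 0 ∈ S` satisfies
`X t ∈ S` for all `t ∈ [0, T]`. For a single constraint this is the strict form
`mem_sublevel_of_solution_of_lt` of `LyapunovSublevelInvariance.lean` without its continuity
hypothesis on `V̇`; for several it is the invariance statement for the max-type Lyapunov function
`V = maxₖ (gₖ − cₖ)` [cite: LinFrancisMaggiore2007, §2.3 Lemma 2.2; DorflerBullo2012, proof of Thm 5.3
(arXiv:0910.5673 §5.2), «positively invariant iff `V(θ(t))` does not increase at any time such that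
`V(θ(t)) = γ`»]. -/
theorem forall_le_of_solution_of_active_lt {F : E → E} {g : ι → E → ℝ} {g' : ι → E → E →L[ℝ] ℝ}
    {c : ι → ℝ} (hg : ∀ k x, HasFDerivAt (g k) (g' k x) x)
    (hface : ∀ x, (∀ j, g j x ≤ c j) → ∀ k, g k x = c k → g' k x (F x) < 0)
    {X : ℝ → E} {T : ℝ} (hX : ∀ t ∈ Icc 0 T, HasDerivWithinAt X (F (X t)) (Icc 0 T) t)
    (h0 : ∀ k, g k (X 0) ≤ c k) : ∀ t ∈ Icc 0 T, ∀ k, g k (X t) ≤ c k := by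
  refine forall_le_of_hasDerivWithinAt_of_eq_imp_deriv_neg
    (h := fun k t => g k (X t)) (h' := fun k t => g' k (X t) (F (X t))) (c := c)
    (fun k t ht => ?_) (fun t _ hall k hk => hface (X t) hall k hk) h0
  exact (hg k (X t)).comp_hasDerivWithinAt t (hX t ht)

end Literature.Analysis.ODE
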